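import Summits.CriticalPhenomena.PercolationContinuityZ3.Theorems.Transplant.SkelNegBParamsSlotsRS
import HarnessLib

/-!
# N1 params, chain of record `NegB`, part KitFloors: the kit pair's SMALL floors by name for p1-g12's one-piece v-face exit table `pexVL_goal`
# (`SkelPhiVLineExitGoals` p298155: `hM : 4C+1 ≤ M_kit`, `hn : 2C ≤ n_kit`, `hn1 : 1 ≤ n_kit` with `C := M_u + 5`) and for `pexXO_spec` — all inside
# `KS.MK = max (24·M_u+63) mk` / `KS.nKit > MK`; plus the ℤ-shape `EqGeom` layer inequality of the kit pair out of `AtQO` (`hEq`)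

builds on p205010 (kernel theorem, internal audit signed; external expert review pending) — nothing in this file uses p205010; NOTHING is claimed about
the node `SamePDropOfSkeletonNeg₁` (OPEN).
Status sentence (coordinator 2026-08-20T04:30Z): "θ(p_c) = 0 on ℤ^d, all d ≥ 2 — kernel-verified (Lean 4/Mathlib, standard axioms); internal adversarial
audit SIGNED 2026-08-20 04:29Z; external expert review pending."
Lane `prim-bschramm-*`, seat `prim-bschramm-stmt` (gen 14); helper file (`--supports stmt-CriticalPhenomena-4575 --as helper`); ledger HOME/prim-bschramm-stmt/NEG-PARAMS.md v0.12.
* `KS.vline_floors` (`4(M_u+5)+1 ≤ MK`, `2(M_u+5) ≤ nKit`, `1 ≤ nKit`, `M_u+3 ≤ nKit`), `KS.vline_floors_int` (ℤ casts), `KS.layerK_of_atQOS` (`(MK+1)·(nKit+|hKit|) ≤ nKit·(ℓKit+1)` at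
  the merged record, ℤ, with `Q := QKO` field names available through `QKO_facts`).
[cite: KozmaNitzan2024, §4 Lemma 10 (pp. 18–21)] [cite: MartineauTassion2017, §3.2 Lemma 3.5]
-/

noncomputable section

open scoped Classical

namespace Summit.CriticalPhenomena.PercolationContinuityZ3.Theorems.Transplant

namespace PlanarSkeletonNeg

namespace NegB

namespace KS

open MeasureTheory Literature.Probability.Percolation Literature.Probability.LatticeModels SimpleGraph
open SkelConc (Consts)
open Skelφ.StepI (DataN OutO)
open Neg

section Floors

variable {V : Type} (D : DataN V) (mk : ℕ)

/-- **The v-line exit floors** (p1-g12 `pexVL_goal` with `C := M_u + 5`): `4(M_u+5)+1 ≤ M_kit`, `2(M_u+5) ≤ n_kit`, `1 ≤ n_kit`, `M_u + 3 ≤ n_kit`. [folklore] -/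
theorem vline_floors : 4 * (Mu D + 5) + 1 ≤ MK D mk ∧ 2 * (Mu D + 5) ≤ nKit D mk ∧ 1 ≤ nKit D mk ∧ Mu D + 3 ≤ nKit D mk := by
  have h1 := (MK_facts D mk).2.1
  have h2 := (nKit_facts D mk).2.1
  have h3 := (nKit_facts D mk).2.2.2.1
  omega

/-- The same floors in `ℤ`. [folklore] -/
theorem vline_floors_int : 4 * ((Mu D : ℤ) + 5) + 1 ≤ (MK D mk : ℤ) ∧ 2 * ((Mu D : ℤ) + 5) ≤ (nKit D mk : ℤ) ∧ (1 : ℤ) ≤ nKit D mk := by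
  obtain ⟨h1, h2, h3, -⟩ := vline_floors D mk
  exact ⟨by exact_mod_cast h1, by exact_mod_cast h2, by exact_mod_cast h3⟩

end Floors

section AtQ

variable {κ : Consts} {V : Type} [DecidableEq V] [Countable V] {G : SimpleGraph V} [G.LocallyFinite] {Φ : PlanarSkeletonNeg G} {t : V} {p : unitInterval}
  {hC : Φ.CylSubcritical p} {gv fv : Neg.FSlot} {Pv : PSlot} {Sv : SSlot} {O : OutO V} {q : unitInterval} (mk : ℕ)

/-- **The kit pair's layer inequality out of `AtQO`** (p1's `hEq`): `(M_kit+1)·(n_kit+|h_kit|) ≤ n_kit·(ℓ_kit+1)` at the merged record, with `M_kit < n_kit`, `M_kit < ℓ_kit`,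
`|v_kit| ≤ n_kit`. [folklore] -/
theorem layerK_of_atQOS (hAt : (choiceAtOS κ Φ t p gv fv Sv hC Pv).AtQO O q) :
    MK O.merged mk < nKit O.merged mk ∧ MK O.merged mk < ℓKit t O.merged mk ∧ |vKit t O.merged mk| ≤ (nKit O.merged mk : ℤ) ∧
      ((MK O.merged mk : ℤ) + 1) * ((nKit O.merged mk : ℤ) + |hKit t O.merged mk|) ≤ (nKit O.merged mk : ℤ) * ((ℓKit t O.merged mk : ℤ) + 1) :=
  eqNumK_of_eqGeom t O.merged mk _ (clauseK_of_atQOS mk hAt).1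

end AtQ

end KS

end NegB

end PlanarSkeletonNeg

end Summit.CriticalPhenomena.PercolationContinuityZ3.Theorems.Transplant

end
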